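import Summits.CriticalPhenomena.PercolationContinuityZ3.Theorems.Transplant.SkelCellsConcGLevels
import HarnessLib

/-!
# L6 (F), part 1 — the REGION of the face step `cond_j` over the cell geometry of record `Skel.cellGeomSG` (generic re-typing of
# `BoxProdZ2ConcFaceRegion` / the region half of `BoxProdZ2ConcFaceStep`, SHEAR-SCOPE §3.9 Layer 6 (F)): the SHRUNK far rows `PCells.farAS`,
# the plain window `Φ.Win w₀ (farAS x du j) (rE_{a'}(x,du))` over them, and why it lies in the span `E^far_{a'}(x,du)`

builds on p205010 (kernel theorem, internal audit signed; external expert review pending) — nothing in this file uses p205010.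
Lane `prim-bschramm`, typed by the `prim-hp-8` lineage (gen 24) on the general-node order of battle (lead 2026-08-20T19:11:07Z (i));
helper file (`--supports stmt-CriticalPhenomena-4575 --as helper`).  NEW FILE over `SkelCellsConcGLevels` (p2-g3) and `PlanarCellsNarrowDefs` (hp-8 g22).

TWO DEPTH-RIM EFFECTS absent from the product (whose regions were full cylinders `π ×ˢ P`): the regions of record are vertex SPANS
(`E^far = VWin w₀ EfarN rE`), while a target step in the window graph `Skel.winGraph G w₀ Rπ` needs a PLAIN window `Win w₀ Dpl Rπ` of full
depth (its levels `Skel.winLData` have depth `Rπ`).  (1) A vertex of depth exactly `Rπ` over `Dpl` lies in the span only if it has a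
`G`-neighbour inside `Win w₀ EfarN rE`: true for `Rπ = rE` when the planar 1-thickening of `Dpl` lies in `EfarN` (its geodesic predecessor
qualifies, by `lip`) — `Win_subset_VWin_of_thicken`.  (2) Every positive-weight support neighbour of the region must have depth `≤ Rπ`: the
cube part `Q_a(x)` of `E_{w,v}` (depth `rQ_a(x)`, unrelated to `rE`) touches the far rows only across the planar levels `5r | 5r + 1`.  Hence the
planar region of the face step is `farAS x du j := cen x + {5r + 10sj + 2 ≤ level ≤ 25r − 1} × [−(5r−2), 5r−2]` (one unit inside `farAN`, two
levels above the cube) and the window depth is `rE_{a'}(x, du)` exactly.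
* §1 planar: `PCells.farAS` + `farAS_subset_farAN/EfarN`, `mem_EfarN_of_near_farAS` (1-thickening), `le_lev_of_mem_farAS`, `Q_sepInf_farAS`,
  `M_add_stepVec_subset_farAS`, the SHIFTED face row `faceLo/faceHi` (planar level `5r + 10s(j+1) − 1`, p2-g3's level shift) and
  **`faceRow_enlarge_subset_farAS`** (`k + 3 ≤ 10 s`);
* §2 skeleton: `exists_adj_mem_graphBall_of_ne` (geodesic predecessor), **`Win_subset_VWin_of_thicken`**, **`Win_farAS_subset_Efar`**
  (`1 ≤ rE`), `M_subset_Win_farAS` (true target inside the region), `Face_subset_Win_faceRow` (`F^{j+1} ⊆ X_0`), `sep_Q_Win_farAS` (no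
  `G`-edge from the cube span into the region).
[cite: KozmaNitzan2024, §4 p. 26 (E_{v,x}, M_x), p. 27 ((30)), p. 30 (Step III: F^{j+1} and the levels above it), p. 31 (D is a subbox of Ω)]
-/

noncomputable section

open scoped Classical

namespace Summit.CriticalPhenomena.PercolationContinuityZ3.Theorems

namespace Transplant

open Literature.Probability.Percolation Literature.Probability.LatticeModels SimpleGraph KNCells Contour
open Literature.Probability.Percolation.KozmaNitzan
open Literature.Probability.Percolation.KozmaNitzan.Cells (oth oth_ne sgOf sgOf_sign stepVec_apply_fst stepVec_apply_oth eq_oth_of_ne oth_oth)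
open Literature.Barriers.CriticalPhenomena (graphBall graphBall_finite mem_graphBall_self graphBall_mono)
open BoxProdZ2 (ConcRadiiG)

/-! ## §1 Planar supplement: the shrunk far rows and the shifted face row -/

namespace PCells

variable (C : PCells)

/-- **The shrunk far rows above the stub of level `j`**: `cen x + {5r + 10 s j + 2 ≤ level ≤ 25 r − 1} × [−(5r − 2), 5r − 2]` — one lattice
unit inside `farAN x du j` on every side and two levels above the cube `Q_x`. [cite: KozmaNitzan2024, §4 p. 30 (the rows above H^j)] -/
def farAS (x : Site 2) (du : MDir) (j : ℕ) : Finset (Site 2) :=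
  sBox du.1 (sgOf du) (C.cen x) (5 * C.r + 10 * C.s * j + 2) (25 * C.r - 1) (5 * C.r - 2)

/-- `farAS ⊆ farAN`. [folklore] -/
theorem farAS_subset_farAN (x : Site 2) (du : MDir) (j : ℕ) : C.farAS x du j ⊆ C.farAN x du j :=
  sBox_mono (sgOf_sign du) _ (by omega) (by omega) (by omega)

/-- `farAS ⊆ EfarN`. [folklore] -/
theorem farAS_subset_EfarN (x : Site 2) (du : MDir) (j : ℕ) : C.farAS x du j ⊆ C.EfarN x du :=
  (C.farAS_subset_farAN x du j).trans (C.farAN_subset_EfarN x du j)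

/-- **The planar 1-thickening of `farAS` lies in `EfarN`.** [folklore] -/
theorem mem_EfarN_of_near_farAS {x : Site 2} {du : MDir} {j : ℕ} {t t' : Site 2} (ht : t ∈ C.farAS x du j)
    (h : ∀ i, |t' i - t i| ≤ 1) : t' ∈ C.EfarN x du := by
  rw [farAS, mem_psBox_iff] at ht
  rw [EfarN, mem_psBox_iff]
  have h1 := abs_le.1 (h du.1)
  have h2 := abs_le.1 (h (oth du.1))
  have hr := C.one_le_r
  refine ⟨?_, by omega⟩
  rcases sgOf_sign du with hs | hs <;> rw [hs] at ht ⊢ <;> constructor <;> nlinarith [ht.1.1, ht.1.2, Nat.zero_le j, C.hs]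

/-- Points of `farAS` have level `≥ 5r + 10 s j + 2 ≥ 5r + 2`. [folklore] -/
theorem le_lev_of_mem_farAS {x : Site 2} {du : MDir} {j : ℕ} {t : Site 2} (ht : t ∈ C.farAS x du j) :
    5 * (C.r : ℤ) + 2 ≤ C.lev du x t := by
  rw [farAS, mem_psBox_iff] at ht
  unfold PCells.lev
  nlinarith [ht.1.1, Nat.zero_le j, C.hs]

/-- **The cube `Q_x` and `farAS x du j` are ℓ^∞-gap separated** (levels `≤ 5r` against `≥ 5r + 2`). [cite: KozmaNitzan2024, §4 p. 26 ((29))] -/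
theorem Q_sepInf_farAS (x : Site 2) (du : MDir) (j : ℕ) : PlanarSkeleton.SepInf (↑(C.Q x) : Set (Site 2)) ↑(C.farAS x du j) := by
  intro y hy z hz
  have h1 : C.lev du x y ≤ 5 * C.r := C.lev_le_of_mem_Q (Finset.mem_coe.1 hy)
  have h2 := C.le_lev_of_mem_farAS (Finset.mem_coe.1 hz)
  refine ⟨du.1, ?_⟩
  unfold PCells.lev at h1 h2
  rw [le_abs]
  rcases sgOf_sign du with hs | hs <;> rw [hs] at h1 h2
  · right; linarith
  · left; linarith

/-- **`M(x + du) ⊆ farAS x du j`** for `j ≤ K` (levels `17r … 23r`, transversally `3r ≤ 5r − 2`). [cite: KozmaNitzan2024, §4 p. 26 (M_x)] -/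
theorem M_add_stepVec_subset_farAS (x : Site 2) (du : MDir) {j : ℕ} (hj : j ≤ C.K) : C.M (x + stepVec du) ⊆ C.farAS x du j := by
  intro t ht
  rw [M, C.mem_sq_iff] at ht
  rw [farAS, mem_psBox_iff]
  have h1 := ht du.1
  have h2 := ht (oth du.1)
  rw [C.cen_add_stepVec_fst] at h1
  rw [C.cen_add_stepVec_oth] at h2
  have hsj : 10 * (C.s : ℤ) * j ≤ 10 * C.r := by
    have : (C.s : ℤ) * j ≤ C.r := by
      have h := Nat.mul_le_mul_left C.s hj
      rw [Nat.mul_comm C.s C.K] at h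
      exact_mod_cast (show C.s * j ≤ C.r from h)
    linarith
  have hr : (1 : ℤ) ≤ C.r := by exact_mod_cast C.one_le_r
  push_cast at h1 h2 ⊢
  refine ⟨?_, by constructor <;> linarith [h2.1, h2.2]⟩
  rcases sgOf_sign du with hs | hs <;> rw [hs] at h1 ⊢ <;> constructor <;> nlinarith [h1.1, h1.2]

/-- **The planar level of the shifted face row `F^{j+1}`**: `5r + 10 s (j+1) − 1` (p2-g3's level shift `L (j+1)` of `Skel.levelDataS`).
[cite: KozmaNitzan2024, §4 p. 30 (F^{j+1})] -/
def faceL (j : ℕ) : ℤ := 5 * (C.r : ℤ) + 10 * (C.s : ℤ) * ((j + 1 : ℕ) : ℤ) - 1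

/-- Lower corner of the shifted face row (a degenerate signed box of transverse half-width `2r`). [folklore] -/
def faceLo (x : Site 2) (du : MDir) (j : ℕ) : Site 2 := sLo du.1 (sgOf du) (C.cen x) (C.faceL j) (C.faceL j) (2 * C.r)

/-- Upper corner of the shifted face row. [folklore] -/
def faceHi (x : Site 2) (du : MDir) (j : ℕ) : Site 2 := sHi du.1 (sgOf du) (C.cen x) (C.faceL j) (C.faceL j) (2 * C.r)

/-- The shifted face row as a signed box. [folklore] -/
theorem Icc_faceLo_faceHi (x : Site 2) (du : MDir) (j : ℕ) :
    Finset.Icc (C.faceLo x du j) (C.faceHi x du j) = sBox du.1 (sgOf du) (C.cen x) (C.faceL j) (C.faceL j) (2 * C.r) := rfl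

/-- A stub point at planar level `faceL j` lies in the shifted face row. [folklore] -/
theorem mem_faceRow_of_mem_Stub {x : Site 2} {du : MDir} {j j' : ℕ} {t : Site 2} (ht : t ∈ C.Stub x du j') (hl : C.lev du x t = C.faceL j) :
    t ∈ Finset.Icc (C.faceLo x du j) (C.faceHi x du j) := by
  rw [Stub, mem_psBox_iff] at ht
  rw [Icc_faceLo_faceHi, mem_psBox_iff]
  unfold PCells.lev at hl
  exact ⟨⟨le_of_eq hl.symm, le_of_eq hl⟩, ht.2⟩

/-- **The `k`-enlargement of the shifted face row lies in `farAS x du j`** when `k + 3 ≤ 10 s` and `j + 1 ≤ K` (along the axis: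
`10 s − 1 − k ≥ 2` below and `≤ 15 r − 1 + k ≤ 25 r − 1` above; transversally `2r + k ≤ 5r − 2` since `k ≤ 10 s − 3 ≤ r/2 − 3`).
[cite: KozmaNitzan2024, §4 p. 30 (the levels above F^{j+1})] -/
theorem faceRow_enlarge_subset_farAS (x : Site 2) (du : MDir) {j k : ℕ} (hj : j + 1 ≤ C.K) (hk : k + 3 ≤ 10 * C.s) :
    Finset.Icc (C.faceLo x du j - (k : Site 2)) (C.faceHi x du j + (k : Site 2)) ⊆ C.farAS x du j := by
  rw [faceLo, faceHi, sBox_enlarge _ _ (sgOf_sign du), farAS, faceL]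
  have hsj : (C.s : ℤ) * (j + 1) ≤ C.r := by
    have h := Nat.mul_le_mul_left C.s hj
    rw [Nat.mul_comm C.s C.K] at h
    exact_mod_cast (show C.s * (j + 1) ≤ C.r from h)
  have h20 := C.twenty_mul_s_le_r
  have hk' : (k : ℤ) + 3 ≤ 10 * C.s := by exact_mod_cast hk
  refine sBox_mono (sgOf_sign du) _ ?_ ?_ ?_ <;> push_cast <;> nlinarith [C.one_le_r, C.hs]

end PCells

/-! ## §2 Windows over the shrunk far rows lie in the span `E^far` -/

namespace PlanarSkeletonConc

variable {V : Type} [DecidableEq V] {G : SimpleGraph V} [G.LocallyFinite] (Φ : PlanarSkeletonConc G)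

omit [DecidableEq V] [G.LocallyFinite] Φ in
/-- **Geodesic predecessor**: a vertex of the ball `B_G(x, n)` other than the centre has a `G`-neighbour in the same ball (the penultimate
vertex of a shortest walk). [folklore] -/
theorem exists_adj_mem_graphBall_of_ne {x y : V} {n : ℕ} (hy : y ∈ graphBall G x n) (hne : y ≠ x) :
    ∃ z ∈ graphBall G x n, G.Adj z y := by
  obtain ⟨w, hw⟩ := hy
  have hr : w.reverse.length ≤ n := by rw [SimpleGraph.Walk.length_reverse]; exact hw
  revert hr
  generalize w.reverse = w'
  intro hr
  cases w' with
  | nil => exact absurd rfl hne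
  | cons hadj w'' =>
    refine ⟨_, ⟨w''.reverse, ?_⟩, hadj.symm⟩
    rw [SimpleGraph.Walk.length_reverse]
    rw [SimpleGraph.Walk.length_cons] at hr
    omega

/-- **A plain window lies in the span of a window over a planar 1-thickening** (depth `≥ 1`): every vertex of `Win w₀ P R` other than the
root has its geodesic predecessor inside `Win w₀ P' R` (`lip`), the root has its `step`-neighbour there. [this work] -/
theorem Win_subset_VWin_of_thicken {w₀ : V} {P P' : Finset (Site 2)} (hP : ∀ t ∈ P, ∀ t' : Site 2, (∀ i, |t' i - t i| ≤ 1) → t' ∈ P')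
    {R : ℕ} (hR : 1 ≤ R) : Φ.Win w₀ P R ⊆ Φ.VWin w₀ P' R := by
  intro y hy
  obtain ⟨hyB, hyP⟩ := Φ.mem_Win.1 hy
  have hyP' : Φ.φ y ∈ P' := hP _ hyP _ fun i => by simp
  by_cases hne : y = w₀
  · subst hne
    refine mem_VWin_of_step (mem_graphBall_self G y 0) (by omega) hyP' (i := 0) (σ := 1) (hP _ hyP _ fun i => ?_)
    by_cases hi : i = 0
    · subst hi; simp
    · simp [hi]
  · obtain ⟨z, hz, hadj⟩ := exists_adj_mem_graphBall_of_ne hyB hne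
    have hzP' : Φ.φ z ∈ P' := hP _ hyP _ fun i => by rw [abs_sub_comm]; exact Φ.lip hadj.symm i
    exact (mem_vspan_edgesIn_of_adj (Φ.mem_Win.2 ⟨hyB, hyP'⟩) (Φ.mem_Win.2 ⟨hz, hzP'⟩) hadj.symm).1

omit [DecidableEq V] in
/-- No `G`-edge joins a vertex over the cube `Q_x` to a vertex over `farAS x du j` (planar ℓ^∞ gap `2`, `lip`). [cite: KozmaNitzan2024, §4 p. 26 ((29))] -/
theorem sep_Q_farAS (C : PCells) (x : Site 2) (du : MDir) (j : ℕ) {X Y : Finset V} (hX : ∀ a ∈ X, Φ.φ a ∈ C.Q x)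
    (hY : ∀ b ∈ Y, Φ.φ b ∈ C.farAS x du j) : KNCells.Sep G X Y :=
  PlanarSkeleton.sep_of_sepInf Φ.toPlanarSkeleton (C.Q_sepInf_farAS x du j) hX hY

end PlanarSkeletonConc

namespace Skel

variable {V : Type} [DecidableEq V] {G : SimpleGraph V} [G.LocallyFinite] (Φ : PlanarSkeletonConc G)
variable (C : PCells) (w₀ : V) {Λ : ConcRadiiG}

open PlanarSkeletonConc

/-- **The face-step window lies in the far region of record**: `Win w₀ (farAS x du j) (rE_{a'}(x,du)) ⊆ E^far_{a'}(x, du)` (a span), as soon as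
`1 ≤ rE_{a'}(x, du)` (automatic under `Skel.WFS`: `ρ + 1 ≤ rE`). [cite: KozmaNitzan2024, §4 p. 31 (D ⊆ Ω)] -/
theorem Win_farAS_subset_Efar {a' : ℕ} {x : Site 2} {du : MDir} (hE : 1 ≤ Λ.rE a' x du) (j : ℕ) :
    Φ.Win w₀ (C.farAS x du j) (Λ.rE a' x du) ⊆ (cellGeomSG Φ C w₀ Λ).Efar a' x du :=
  Φ.Win_subset_VWin_of_thicken (fun _ ht _ h => C.mem_EfarN_of_near_farAS ht h) hE

/-- `1 ≤ rE` under `WFS`. [folklore] -/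
theorem WFS.one_le_rE {C : PCells} {Λ : ConcRadiiG} (hΛ : WFS C Λ) (a : ℕ) (v : Site 2) (δ : MDir) : 1 ≤ Λ.rE a v δ :=
  le_trans (by omega) (hΛ.ρE1 a v δ 0)

/-- **The true target lies in the face-step window**: `M_{a'}(x + du) ⊆ Win w₀ (farAS x du j) (rE_{a'}(x,du))` (`j ≤ K`, `rM ≤ rE`).
[cite: KozmaNitzan2024, §4 p. 26 (M_x ⊆ E_{v,x})] -/
theorem M_subset_Win_farAS (hW : Λ.WF C) {a' : ℕ} (x : Site 2) (du : MDir) {j : ℕ} (hj : j ≤ C.K) :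
    (cellGeomSG Φ C w₀ Λ).M a' (x + stepVec du) ⊆ Φ.Win w₀ (C.farAS x du j) (Λ.rE a' x du) := by
  change Φ.VWin w₀ (C.M (x + stepVec du)) (Λ.rM a' (x + stepVec du)) ⊆ _
  exact (Φ.VWin_subset_Win w₀ _ _).trans (Φ.Win_mono (C.M_add_stepVec_subset_farAS x du hj) (hW.ME a' x du))

/-- **The face `F^{j+1}` lies in the zeroth level window over the shifted face row**: `Face_{a'}(x, du, j+1) ⊆ Win w₀ [faceLo, faceHi] rE`.
[cite: KozmaNitzan2024, §4 p. 30 (Step III: the source box F^{j+1})] -/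
theorem Face_subset_Win_faceRow (hW : Λ.WF C) (a' : ℕ) (x : Site 2) (du : MDir) (j : ℕ) :
    (faceDataSG Φ C w₀ Λ).Face a' x du (j + 1) ⊆ Φ.Win w₀ (Finset.Icc (C.faceLo x du j) (C.faceHi x du j)) (Λ.rE a' x du) := by
  intro y hy
  change y ∈ (Φ.VStair w₀ (C.Stub x du (j + 1)) (prof C Λ a' x du)).filter
    (fun y => C.lev du x (Φ.φ y) = 5 * (C.r : ℤ) + 10 * (C.s : ℤ) * (j + 1 : ℕ) - 1) at hy
  obtain ⟨hy, hl⟩ := Finset.mem_filter.1 hy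
  obtain ⟨hP, hd⟩ := mem_of_mem_VStair hy
  exact Φ.mem_Win.2 ⟨graphBall_mono G w₀ (hW.ρE a' x du _) hd, C.mem_faceRow_of_mem_Stub hP hl⟩

/-- **No `G`-edge from the cube span `Q_a(x)` into the face-step window.** [cite: KozmaNitzan2024, §4 p. 26 ((29))] -/
theorem sep_Q_Win_farAS (a : ℕ) (x : Site 2) (du : MDir) (j R : ℕ) :
    KNCells.Sep G ((cellGeomSG Φ C w₀ Λ).Q a x) (Φ.Win w₀ (C.farAS x du j) R) :=
  Φ.sep_Q_farAS C x du j (fun _ ha => φ_mem_of_mem_VWin ha) (fun _ hb => (Φ.mem_Win.1 hb).2)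

/-- The face-step window misses the stub span `Stub_{a'}(x, du, j')` (planar footprints: `farAN ∩ Stub = ∅`). [folklore] -/
theorem disjoint_Win_farAS_Stub (a' : ℕ) (x : Site 2) (du : MDir) (j R : ℕ) :
    Disjoint (Φ.Win w₀ (C.farAS x du j) R) ((cellGeomSG Φ C w₀ Λ).Stub a' x du j) := by
  change Disjoint _ (Φ.VStair w₀ (C.Stub x du j) (prof C Λ a' x du))
  exact disjoint_of_φ (fun _ ha => C.farAS_subset_farAN x du j (Φ.mem_Win.1 ha).2) (fun _ hb => (mem_of_mem_VStair hb).1)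
    (C.farAN_disjoint_Stub x du j)

/-- The face-step window misses `E_{w,v}` of the incoming edge (planar footprints: `EwvN ∩ EfarN = ∅` for `du ≠ rev δw`). [folklore] -/
theorem disjoint_Win_farAS_Ewv (a : ℕ) (w : Site 2) {δw du : MDir} (hne : du ≠ rev δw) (j R : ℕ) :
    Disjoint (Φ.Win w₀ (C.farAS (w + stepVec δw) du j) R) ((cellGeomSG Φ C w₀ Λ).Ewv a w δw) := by
  have h := C.EwvN_disjoint_EfarN w hne
  rw [PCells.EwvN, Finset.disjoint_union_left] at h
  change Disjoint _ (Φ.VWin w₀ (C.BtwN w δw) (Λ.rB a w δw) ∪ Φ.VWin w₀ (C.Q (w + stepVec δw)) (Λ.rQ a (w + stepVec δw)))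
  rw [Finset.disjoint_union_right]
  exact ⟨disjoint_of_φ (fun _ ha => C.farAS_subset_EfarN _ du j (Φ.mem_Win.1 ha).2) (fun _ hb => φ_mem_of_mem_VWin hb) h.1.symm,
    disjoint_of_φ (fun _ ha => C.farAS_subset_EfarN _ du j (Φ.mem_Win.1 ha).2) (fun _ hb => φ_mem_of_mem_VWin hb) h.2.symm⟩

end Skel

end Transplant

end Summit.CriticalPhenomena.PercolationContinuityZ3.Theorems

end
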